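import Literature.Probability.FitznerVanDerHofstad2017.SrwIntegralBounds
import HarnessLib

/-!
# The `W`-split Cauchy–Schwarz bounds for `K_{n,l}(x)`

CITATION HEADER (PLACEMENT v2). Part of the certified REPRODUCTION of
R. Fitzner, R. van der Hofstad, *Generalized approach to the non-backtracking lace expansion*,
Probab. Theory Related Fields 169 (2017) 1041–1119 [NoBLE17] (arXiv:1506.07969), §5.2, as consumed by
*Mean-field behavior for nearest-neighbor percolation in `d > 10`*, Electron. J. Probab. 22 (2017)
no. 43 [FvdH17]. Origin: build `lace`, unit `b2b-lace-tail-g2` (divergence D39 "KSUP": the bound on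
`sup_{x ≠ 0} K_{n,l}(x)`).

## What is proved, and why

[NoBLE17] (5.9) bounds `K_{n,l}(x) = ∫ |D̂|^l Ĉⁿ |D̂^{(x)}|` by Cauchy–Schwarz with the split
`|D̂|^l · |D̂^{(x)}|`, giving `[I_{n,2l}(0) L_n(x)]^{1/2}`, `L_n(x) = ∫ Ĉⁿ (D̂^{(x)})²`. For `x ≠ 0, ±e_i`
this is the only printed bound, and it is poor for large `l` because `(D̂^{(x)})²` has mean
`1/|orbit(x)|` over the torus irrespective of `D̂`. Splitting instead as `|D̂|^m · (|D̂|^j |D̂^{(x)}|)`,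
`l = m + j`, gives the family (same proof as (5.9), [HS92b] (B.25)–(B.27))

  `K_{n,m+j}(x) ≤ [I_{n,2m}(0)]^{1/2} [W_{n,j}(x)]^{1/2}`,  `W_{n,j}(x) := ∫ D̂^{2j} (D̂^{(x)})² Ĉⁿ dk/(2π)^d`
  (`srwK_le_sqrt_srwI_mul_srwW`; `j = 0` is (5.9) since `W_{n,0} = L_n`, `srwW_zero`),

valid at every fixed `x` with no hypothesis beyond `d ≥ 2n + 1`. `W_{n,j}(x)` is computable from the
tabulated `I_{n,2j}` at the placement nodes of `x` exactly as `L_n` is from `I_{n,0}` ((5.16)); at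
`x = e_i`, `W_{n,j}(e_i) = I_{n,2j+2}(0)` (`srwW_single`), so the family contains the printed `x = 0`
rules (5.14) for `K_{n,l}(e_i) = K_{n,l+1}(0)` (`srwK_single_le_sqrt`). Numerically (build `lace`,
`b2b-lace-tail-g2/KSUP.md` §5b) `min_j` of the family at `x = 2e₁, e₁+e₂` is within 2–25 % of the true
`K` and below the `x = e₁` cell in every cell used at `d = 10, 11, 12`.

USING the family for `sup_{‖x‖₂ > 1} K_{n,l}(x)` requires the monotonicity of `x ↦ W_{n,j}(x)` in the
DOMINANCE ORDER of [NoBLE17] Lemma 5.1 — `W_{n,j}(x + y) ≤ W_{n,j}(x)` for `x`, `y` sorted,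
`x₁ ≥ … ≥ x_d ≥ 0`, `y₁ ≥ … ≥ y_d ≥ 0` (for `j = 0` this is the `L_n`-clause of [NoBLE17] Lemma 5.1, cf.
Hara–Slade 1992b Lemma B.4); the COORDINATEWISE single-step form (`x ↦ x + e_ι`, `x_ι ≥ 0`) is FALSE:
`L₁(2e₁+2e₂) > L₁(2e₁+e₂)` at `d = 11` (exact counts, HOME/REFEREE2.md §AC, AC2: coalescing coordinates halves
the orbit), while the sorted form has no violation in any exact test (AC3) and suffices for the sup, since every
sorted `x ∉ {0, e₁}` dominates `2e₁` or `e₁+e₂` (AC4).  For `j ≥ 1` even the sorted form is NOT in print and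
NOT proved here — it enters only as the user-supplied hypothesis `hW` of `srwK_le_sqrt_of_srwW_le`. No `sorry`.
-/

open MeasureTheory Real

namespace Literature.Probability.FitznerVanDerHofstad2017

open Literature.Barriers.CriticalPhenomena
open Literature.Barriers.CriticalPhenomena.Slade2006Prop53 (P)

variable {d : ℕ}

/-- `W_{n,j}(x) = ∫_{[-π,π]^d} D̂(k)^{2j} D̂^{(x)}(k)² Ĉ(k)ⁿ dk/(2π)^d` (`W_{n,0} = L_n`).
[cite: FitznerVanDerHofstad2016NoBLE, (5.7) p. 1091 (the case j = 0)] -/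
noncomputable def srwW (d n j : ℕ) (x : Fin d → ℤ) : ℝ :=
  (∫ k, (Dhat d k ^ (2 * j) * DhatSym d x k ^ 2) * Chat d 1 k ^ n ∂P d) / (2 * π) ^ d

/-- `W_{n,0}(x) = L_n(x)`. [cite: FitznerVanDerHofstad2016NoBLE, (5.7) p. 1091] -/
theorem srwW_zero (n : ℕ) (x : Fin d → ℤ) : srwW d n 0 x = srwL d n x := by
  unfold srwW srwL
  simp only [mul_zero, pow_zero, one_mul]

/-- `W_{n,j}(x) ≥ 0`. [folklore] -/
theorem srwW_nonneg (n j : ℕ) (x : Fin d → ℤ) : 0 ≤ srwW d n j x :=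
  div_nonneg (integral_nonneg fun k => mul_nonneg
    (mul_nonneg (by rw [pow_mul]; exact pow_nonneg (sq_nonneg _) j) (sq_nonneg _))
    (pow_nonneg (Chat_one_nonneg k) n)) (two_pi_pow_pos d).le

/-- The `W`-integrand is integrable for `d ≥ 2n + 1`. [folklore] -/
theorem integrable_srwW_integrand {n : ℕ} (hd : 2 * n + 1 ≤ d) (j : ℕ) (x : Fin d → ℤ) :
    Integrable (fun k => (Dhat d k ^ (2 * j) * DhatSym d x k ^ 2) * Chat d 1 k ^ n) (P d) := by
  refine integrable_weight_mul_Chat_pow hd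
    (((continuous_Dhat d).measurable.pow_const (2 * j)).mul ((measurable_DhatSym d x).pow_const 2))
    fun k => ?_
  rw [abs_mul, abs_pow, abs_pow]
  exact mul_le_one₀ (abs_Dhat_pow_le_one (2 * j) k) (pow_nonneg (abs_nonneg _) 2)
    (pow_le_one₀ (abs_nonneg _) (abs_DhatSym_le_one x k))

/-- `W_{n,j}(e_i) = I_{n,2j+2}(0)` (since `D̂^{(e_i)} = D̂`, `D̂^{(0)} = 1`).
[cite: FitznerVanDerHofstad2016NoBLE, (3.34) p. 1071] -/
theorem srwW_single (n j : ℕ) (i : Fin d) :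
    srwW d n j (Pi.single i 1) = srwI d n (2 * j + 2) 0 := by
  unfold srwW srwI
  congr 1
  refine integral_congr_ae (ae_of_all _ fun k => ?_)
  simp only [DhatSym_single, DhatSym_zero, mul_one]
  ring

/-- **`W`-split Cauchy–Schwarz bound**: `K_{n,m+j}(x) ≤ [I_{n,2m}(0)]^{1/2} [W_{n,j}(x)]^{1/2}`
(`d ≥ 2n + 1`; `j = 0` is (5.9)). [cite: FitznerVanDerHofstad2016NoBLE, (5.9) p. 1091] -/
theorem srwK_le_sqrt_srwI_mul_srwW {n : ℕ} (hd : 2 * n + 1 ≤ d) (m j : ℕ) (x : Fin d → ℤ) :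
    srwK d n (m + j) x ≤ Real.sqrt (srwI d n (2 * m) 0) * Real.sqrt (srwW d n j x) := by
  refine le_sqrt_mul_sqrt_of_forall (srwI_zero_even_nonneg n m) (srwW_nonneg n j x)
    fun lam hl => ?_
  have hA := integrable_srwI_integrand hd (2 * m) (0 : Fin d → ℤ)
  have hB := integrable_srwW_integrand hd j x (n := n)
  have key : ∫ k, (|Dhat d k| ^ (m + j) * |DhatSym d x k|) * Chat d 1 k ^ n ∂P d ≤
      ∫ k, (lam * ((Dhat d k ^ (2 * m) * DhatSym d 0 k) * Chat d 1 k ^ n) +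
        lam⁻¹ * ((Dhat d k ^ (2 * j) * DhatSym d x k ^ 2) * Chat d 1 k ^ n)) / 2 ∂P d := by
    refine integral_mono_of_nonneg (ae_of_all _ fun k => ?_)
      (((hA.const_mul lam).add (hB.const_mul lam⁻¹)).div_const 2) (ae_of_all _ fun k => ?_)
    · exact mul_nonneg (mul_nonneg (pow_nonneg (abs_nonneg _) _) (abs_nonneg _))
        (pow_nonneg (Chat_one_nonneg k) n)
    · have h := abs_mul_abs_le_am_gm (Dhat d k ^ m) (Dhat d k ^ j * DhatSym d x k) hl
      have hC := pow_nonneg (Chat_one_nonneg k) n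
      have hsplit : |Dhat d k| ^ (m + j) * |DhatSym d x k|
          = |Dhat d k ^ m| * |Dhat d k ^ j * DhatSym d x k| := by
        rw [abs_mul, abs_pow, abs_pow, pow_add]; ring
      show |Dhat d k| ^ (m + j) * |DhatSym d x k| * Chat d 1 k ^ n ≤
        (lam * (Dhat d k ^ (2 * m) * DhatSym d 0 k * Chat d 1 k ^ n) +
          lam⁻¹ * (Dhat d k ^ (2 * j) * DhatSym d x k ^ 2 * Chat d 1 k ^ n)) / 2
      rw [hsplit]
      have h2 := mul_le_mul_of_nonneg_right h hC
      refine h2.trans (le_of_eq ?_)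
      simp only [DhatSym_zero]
      ring
  have e : ∫ k, (lam * ((Dhat d k ^ (2 * m) * DhatSym d 0 k) * Chat d 1 k ^ n) +
        lam⁻¹ * ((Dhat d k ^ (2 * j) * DhatSym d x k ^ 2) * Chat d 1 k ^ n)) / 2 ∂P d =
      (lam * (∫ k, (Dhat d k ^ (2 * m) * DhatSym d 0 k) * Chat d 1 k ^ n ∂P d) +
        lam⁻¹ * ∫ k, (Dhat d k ^ (2 * j) * DhatSym d x k ^ 2) * Chat d 1 k ^ n ∂P d) / 2 := by
    rw [integral_div, integral_add (hA.const_mul lam) (hB.const_mul lam⁻¹), integral_const_mul,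
      integral_const_mul]
  unfold srwK srwI srwW
  calc (∫ k, (|Dhat d k| ^ (m + j) * |DhatSym d x k|) * Chat d 1 k ^ n ∂P d) / (2 * π) ^ d
      ≤ ((lam * (∫ k, (Dhat d k ^ (2 * m) * DhatSym d 0 k) * Chat d 1 k ^ n ∂P d) +
          lam⁻¹ * ∫ k, (Dhat d k ^ (2 * j) * DhatSym d x k ^ 2) * Chat d 1 k ^ n ∂P d) / 2)
          / (2 * π) ^ d :=
        div_le_div_of_nonneg_right (key.trans_eq e) (two_pi_pow_pos d).le
    _ = _ := by ring

/-- The family at `x = e_i`: `K_{n,m+j}(e_i) (= K_{n,m+j+1}(0)) ≤ [I_{n,2m}(0) I_{n,2j+2}(0)]^{1/2}`;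
`m = j + 1` recovers `K_{n,2j+2}(0) = I_{n,2j+2}(0)` and `m = j` the printed odd rule (5.14).
[cite: FitznerVanDerHofstad2016NoBLE, (5.14) p. 1092] -/
theorem srwK_single_le_sqrt {n : ℕ} (hd : 2 * n + 1 ≤ d) (m j : ℕ) (i : Fin d) :
    srwK d n (m + j) (Pi.single i 1)
      ≤ Real.sqrt (srwI d n (2 * m) 0) * Real.sqrt (srwI d n (2 * j + 2) 0) := by
  have h := srwK_le_sqrt_srwI_mul_srwW hd m j (Pi.single i 1)
  rwa [srwW_single] at h

/-- Glue for the sup-over-`x` step: if `W_{n,j}(x) ≤ W` (e.g. `W = max(W_{n,j}(2e₁), W_{n,j}(e₁+e₂))`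
for `‖x‖₂ > 1`, a monotonicity statement in the dominance order of Lemma 5.1 (sorted `x ↦ x + y`, see the
module docstring; the coordinatewise form is false) NOT proved here — hypothesis `hW`), then
`K_{n,m+j}(x) ≤ √(I_{n,2m}(0)) √W`. [cite: FitznerVanDerHofstad2016NoBLE, Lemma 5.1 p. 1098 (j = 0)] -/
theorem srwK_le_sqrt_of_srwW_le {n : ℕ} (hd : 2 * n + 1 ≤ d) (m j : ℕ) (x : Fin d → ℤ) {W : ℝ}
    (hW : srwW d n j x ≤ W) :
    srwK d n (m + j) x ≤ Real.sqrt (srwI d n (2 * m) 0) * Real.sqrt W :=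
  (srwK_le_sqrt_srwI_mul_srwW hd m j x).trans
    (mul_le_mul_of_nonneg_left (Real.sqrt_le_sqrt hW) (Real.sqrt_nonneg _))

end Literature.Probability.FitznerVanDerHofstad2017
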